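import Summits.CriticalPhenomena.PercolationContinuityZ3.Theorems.PercNearOneGluingNoHeavyLowerTailSwitchingKCopies
import HarnessLib

/-!
# `NoHeavyLowerTail` (stmt-CriticalPhenomena-4575) — k-copy switching, II: every sequential exploration program
# (`r` steps, `k` copies) is a weight-preserving bijection of the `k`-tuple space, hence preserves `μ^{⊗k}`

Support file (prover prim-masterthm-p1, MASTER THEOREM P1 = k-uniform switching schema; `--supports stmt-CriticalPhenomena-4575`).
No named facts, no sorries.

PROGRAMS of the k-uniform certificate schema (`prim-masterthm-p1/SCHEMA-K.md`): "explore a region `R 0 (x 0)` of copy `0` and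
exchange copies `0` and `T 0` on it; then a region `R 1 (x 0)` disjoint from it, determined by `x 0` on `R 0 (x 0) ∪ R 1 (x 0)`,
exchanged with copy `T 1`; …" (`r` steps; in the schema `R s` = the edges meeting the cluster of the `s`-th root explored
through the not-yet-queried edges).  This file proves ONCE, for every number of copies `k` and of steps `r`, that such a
program is injective (explicit left inverse built by recovering the regions FORWARD from the output, `reg_seqSplice`) and
permutes the copies coordinatewise, hence preserves the `k`-tuple law: **`sum_wtKW_comp_seqSplice`**.  The case
`k = 3, r = 2` is the tree's `DecisionTree.splice3` / `sum_wt3W_comp_splice3` [GladkovZimin2024, Lemma 4.2 and proof of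
Thm. 4.6 (successive explorations); Gladkov2024, Def. 2.4 / Lemma 3.1 (self-determined sets)]; the proof is the same
uniqueness-of-the-tree-path argument.

* `recv`, `used`, `seqSplice` — received regions and the output tuple; `RegionsDisjoint`, `RegionsDetermined` — hypotheses;
* `permutesCopiesK_seqSplice`, `seqSplice_mem_tuplesK`; `regs`/`reg`, `reg_seqSplice` (regions recovered);
  `unSeqSplice`, `unSeqSplice_seqSplice`, `seqSplice_injective`; **`sum_wtKW_comp_seqSplice`**.
-/

noncomputable section

open Classical

namespace Summit.CriticalPhenomena.PercolationContinuityZ3.Theorems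

namespace SwitchingK

open Finset Literature.Probability.Percolation Literature.Probability.Percolation.DecisionTree

variable {ι : Type*} [DecidableEq ι] {k : ℕ}

/-! ### Sequential exploration programs: regions `R s (x 0)` of copy `0` handed to copies `T s`

A program is given by region maps `R : ℕ → Finset ι → Finset ι` (step `s` hands the region `R s K` of copy `0`, read off
the configuration `K = x 0` of copy `0`), targets `T : ℕ → Fin k` and a number of steps `r`.  The hypotheses under which
it is a bijection are those of [Gladkov2024, Def. 2.4 / Lemma 3.1] iterated: the regions of one configuration are pairwise
disjoint, no step targets copy `0`, and `R s K` is determined by `K` on `R 0 K ∪ ⋯ ∪ R s K` (a region explored through the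
not-yet-queried coordinates is determined by what the exploration has seen so far). -/

section Seq

/-- The region RECEIVED by copy `j` from copy `0`: the union of the regions `R s K`, `s < r`, with target `T s = j`.
[cite: GladkovZimin2024, Def. 4.1 (the set `S` given to the other copy); k-copy sequential form] -/
def recv (R : ℕ → Finset ι → Finset ι) (T : ℕ → Fin k) (r : ℕ) (K : Finset ι) (j : Fin k) : Finset ι :=
  (Finset.range r).biUnion fun s => if T s = j then R s K else ∅

/-- The union of all regions handed out by the program. [cite: GladkovZimin2024, Def. 4.1; k-copy sequential form] -/
def used (R : ℕ → Finset ι → Finset ι) (r : ℕ) (K : Finset ι) : Finset ι := (Finset.range r).biUnion fun s => R s K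

/-- The output tuple of the sequential program: copy `0` receives, on each region `R s (x 0)`, the bits of copy `T s` and keeps
its own bits elsewhere; copy `j ≠ 0` receives the bits of copy `0` on `recv (x 0) j` and keeps its own elsewhere.
[cite: GladkovZimin2024, Def. 4.1 and proof of Thm. 4.6 (successive explorations); k-copy sequential form] -/
def seqSplice [NeZero k] (R : ℕ → Finset ι → Finset ι) (T : ℕ → Fin k) (r : ℕ) (x : Fin k → Finset ι) :
    Fin k → Finset ι := fun j =>
  if j = 0 then ((x 0) \ used R r (x 0)) ∪ (Finset.range r).biUnion (fun s => x (T s) ∩ R s (x 0))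
  else splice (recv R T r (x 0) j) (x 0) (x j)

variable {R : ℕ → Finset ι → Finset ι} {T : ℕ → Fin k} {r : ℕ}

/-- Membership in `recv`. [folklore] -/
theorem mem_recv {K : Finset ι} {j : Fin k} {i : ι} : i ∈ recv R T r K j ↔ ∃ s, s < r ∧ T s = j ∧ i ∈ R s K := by
  unfold recv
  simp only [mem_biUnion, mem_range]
  constructor
  · rintro ⟨s, hs, hi⟩
    by_cases h : T s = j
    · rw [if_pos h] at hi; exact ⟨s, hs, h, hi⟩
    · rw [if_neg h] at hi; simp at hi
  · rintro ⟨s, hs, h, hi⟩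
    exact ⟨s, hs, by rw [if_pos h]; exact hi⟩

/-- Membership in `used`. [folklore] -/
theorem mem_used {K : Finset ι} {i : ι} : i ∈ used R r K ↔ ∃ s, s < r ∧ i ∈ R s K := by
  unfold used; simp only [mem_biUnion, mem_range]

/-- Pairwise disjointness of the regions of one configuration. [cite: Gladkov2024, Def. 2.4 (disjoint explored sets)] -/
def RegionsDisjoint (R : ℕ → Finset ι → Finset ι) (r : ℕ) : Prop :=
  ∀ K s s', s < r → s' < r → s ≠ s' → Disjoint (R s K) (R s' K)

/-- Step `s`'s region is determined by the configuration on the regions of steps `≤ s` (one-sided form, as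
`SelfDetermined`). [cite: Gladkov2024, Def. 2.4 and Lemma 3.1 (a set built by a decision tree reading `C₁` is determined by
`C₁` on the queried coordinates); sequential form] -/
def RegionsDetermined (R : ℕ → Finset ι → Finset ι) (r : ℕ) : Prop :=
  ∀ s, s < r → ∀ K K' : Finset ι, (∀ i, (∃ j, j ≤ s ∧ i ∈ R j K) → (i ∈ K ↔ i ∈ K')) → R s K' = R s K

omit [DecidableEq ι] in
/-- Under disjointness, the step whose region contains a given coordinate is unique. [folklore] -/
theorem step_unique [DecidableEq ι] (hd : RegionsDisjoint R r) {K : Finset ι} {i : ι} {s s' : ℕ} (hs : s < r)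
    (hs' : s' < r) (hi : i ∈ R s K) (hi' : i ∈ R s' K) : s = s' := by
  by_contra h
  exact Finset.disjoint_left.1 (hd K s s' hs hs' h) hi hi'

/-- Output copy `0` of the program. [cite: GladkovZimin2024, Def. 4.1] -/
theorem seqSplice_zero [NeZero k] (x : Fin k → Finset ι) :
    seqSplice R T r x 0 = ((x 0) \ used R r (x 0)) ∪ (Finset.range r).biUnion (fun s => x (T s) ∩ R s (x 0)) := by
  unfold seqSplice; rw [if_pos rfl]

/-- Output copy `j ≠ 0`: the bits of copy `0` on `recv (x 0) j`, its own elsewhere. [cite: GladkovZimin2024, Def. 4.1] -/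
theorem seqSplice_ne_zero [NeZero k] (x : Fin k → Finset ι) {j : Fin k} (hj : j ≠ 0) :
    seqSplice R T r x j = splice (recv R T r (x 0) j) (x 0) (x j) := by
  unfold seqSplice; rw [if_neg hj]

/-- Output copy `0` at a coordinate of the region of step `s`: the bit of copy `T s`. [cite: GladkovZimin2024, Def. 4.1] -/
theorem mem_seqSplice_zero_of_mem [NeZero k] (hd : RegionsDisjoint R r) {x : Fin k → Finset ι} {i : ι} {s : ℕ}
    (hs : s < r) (hi : i ∈ R s (x 0)) : i ∈ seqSplice R T r x 0 ↔ i ∈ x (T s) := by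
  rw [seqSplice_zero]
  simp only [mem_union, mem_sdiff, mem_biUnion, mem_range, mem_inter]
  have hu : i ∈ used R r (x 0) := mem_used.2 ⟨s, hs, hi⟩
  constructor
  · rintro (⟨-, hnu⟩ | ⟨s', hs', hx', hi'⟩)
    · exact absurd hu hnu
    · rwa [step_unique hd hs hs' hi hi']
  · intro h; exact Or.inr ⟨s, hs, h, hi⟩

/-- Output copy `0` off the handed-out regions: its own bit. [cite: GladkovZimin2024, Def. 4.1] -/
theorem mem_seqSplice_zero_of_not_mem [NeZero k] {x : Fin k → Finset ι} {i : ι} (hi : i ∉ used R r (x 0)) :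
    i ∈ seqSplice R T r x 0 ↔ i ∈ x 0 := by
  rw [seqSplice_zero]
  simp only [mem_union, mem_sdiff, mem_biUnion, mem_range, mem_inter]
  constructor
  · rintro (⟨h, -⟩ | ⟨s', hs', -, hi'⟩)
    · exact h
    · exact absurd (mem_used.2 ⟨s', hs', hi'⟩) hi
  · intro h; exact Or.inl ⟨h, hi⟩

/-- The sequential program permutes the copies coordinatewise: transposition `(0, T s)` on `R s (x 0)`, identity off the
regions. [cite: GladkovZimin2024, Def. 4.1; k-copy sequential form] -/
theorem permutesCopiesK_seqSplice [NeZero k] (hd : RegionsDisjoint R r) :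
    PermutesCopiesK (seqSplice R T r) := by
  intro x i
  by_cases hu : i ∈ used R r (x 0)
  · obtain ⟨s, hs, hi⟩ := mem_used.1 hu
    refine ⟨Equiv.swap 0 (T s), fun j => ?_⟩
    by_cases hj0 : j = 0
    · subst hj0
      rw [Equiv.swap_apply_left]
      exact mem_seqSplice_zero_of_mem hd hs hi
    · by_cases hjT : j = T s
      · subst hjT
        rw [Equiv.swap_apply_right, seqSplice_ne_zero x hj0, mem_splice_of_mem (mem_recv.2 ⟨s, hs, rfl, hi⟩)]
      · rw [Equiv.swap_apply_of_ne_of_ne hj0 hjT, seqSplice_ne_zero x hj0]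
        have hnr : i ∉ recv R T r (x 0) j := by
          intro h
          obtain ⟨s', hs', hTs', hi'⟩ := mem_recv.1 h
          have := step_unique hd hs hs' hi hi'
          subst this
          exact hjT hTs'.symm
        rw [mem_splice_of_not_mem hnr]
  · refine ⟨Equiv.refl _, fun j => ?_⟩
    by_cases hj0 : j = 0
    · subst hj0
      simpa using mem_seqSplice_zero_of_not_mem hu
    · rw [seqSplice_ne_zero x hj0]
      have hnr : i ∉ recv R T r (x 0) j := fun h => by
        obtain ⟨s', hs', -, hi'⟩ := mem_recv.1 h
        exact hu (mem_used.2 ⟨s', hs', hi'⟩)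
      rw [mem_splice_of_not_mem hnr]; simp

/-- The program maps tuples inside `D` to tuples inside `D`. [folklore] -/
theorem seqSplice_mem_tuplesK [NeZero k] {D : Finset ι} {x : Fin k → Finset ι} (hx : x ∈ tuplesK D k) :
    seqSplice R T r x ∈ tuplesK D k := by
  have h := mem_tuplesK.1 hx
  refine mem_tuplesK.2 fun j => ?_
  by_cases hj0 : j = 0
  · subst hj0
    intro i hi
    rw [seqSplice_zero] at hi
    simp only [mem_union, mem_sdiff, mem_biUnion, mem_range, mem_inter] at hi
    rcases hi with ⟨hi, -⟩ | ⟨s, -, hi, -⟩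
    · exact h 0 hi
    · exact h (T s) hi
  · rw [seqSplice_ne_zero x hj0]
    exact splice_subset (h 0) (h j)

/-! ### Recovering the regions from the output, forward in the step order -/

/-- `regs R T y s` lists the first `s` regions reconstructed from the output tuple `y` (and `∅` from index `s` on): region
`s` is `R s` applied to the configuration that equals `y (T j)` on the reconstructed region `j < s` and `y (T s)` elsewhere —
a configuration agreeing with the input `x 0` on `R 0 (x 0) ∪ ⋯ ∪ R s (x 0)`. [cite: GladkovZimin2024, proof of Lemma 4.2
(uniqueness of the tree path); k-copy sequential form] -/
def regs (R : ℕ → Finset ι → Finset ι) (T : ℕ → Fin k) (y : Fin k → Finset ι) : ℕ → ℕ → Finset ι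
  | 0 => fun _ => ∅
  | s + 1 => fun j =>
      if j < s then regs R T y s j
      else if j = s then
        R s ((y (T s) \ (Finset.range s).biUnion (regs R T y s)) ∪
              (Finset.range s).biUnion (fun l => y (T l) ∩ regs R T y s l))
      else ∅

/-- The reconstructed region `j` (read at stage `j + 1`). [folklore] -/
def reg (R : ℕ → Finset ι → Finset ι) (T : ℕ → Fin k) (y : Fin k → Finset ι) (j : ℕ) : Finset ι :=
  regs R T y (j + 1) j

/-- The successor stage of `regs`, unfolded. [folklore] -/
theorem regs_succ (y : Fin k → Finset ι) (s j : ℕ) :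
    regs R T y (s + 1) j = (if j < s then regs R T y s j
      else if j = s then
        R s ((y (T s) \ (Finset.range s).biUnion (regs R T y s)) ∪
              (Finset.range s).biUnion (fun l => y (T l) ∩ regs R T y s l))
      else ∅) := rfl

/-- `regs` is stable: for `j < s ≤ s'`, `regs y s' j = regs y s j`. [folklore] -/
theorem regs_stable (y : Fin k → Finset ι) {j s : ℕ} (hjs : j < s) : ∀ s', s ≤ s' → regs R T y s' j = regs R T y s j := by
  intro s' hss'
  induction s' with
  | zero => exact absurd (Nat.lt_of_lt_of_le hjs hss') (Nat.not_lt_zero j)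
  | succ n ih =>
      rcases Nat.eq_or_lt_of_le hss' with h | h
      · rw [h]
      · have hn : s ≤ n := Nat.lt_succ_iff.1 h
        have hjn : j < n := Nat.lt_of_lt_of_le hjs hn
        rw [regs_succ, if_pos hjn, ih hn]

/-- For `j < s`, stage `s` already holds the reconstructed region `j`. [folklore] -/
theorem regs_eq_reg (y : Fin k → Finset ι) {j s : ℕ} (hjs : j < s) : regs R T y s j = reg R T y j :=
  regs_stable y (Nat.lt_succ_self j) s hjs

/-- The defining equation of `reg`. [folklore] -/
theorem reg_eq (y : Fin k → Finset ι) (s : ℕ) :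
    reg R T y s = R s ((y (T s) \ (Finset.range s).biUnion (reg R T y)) ∪
      (Finset.range s).biUnion (fun l => y (T l) ∩ reg R T y l)) := by
  have hb1 : (Finset.range s).biUnion (regs R T y s) = (Finset.range s).biUnion (reg R T y) :=
    Finset.biUnion_congr rfl fun l hl => regs_eq_reg y (mem_range.1 hl)
  have hb2 : (Finset.range s).biUnion (fun l => y (T l) ∩ regs R T y s l) =
      (Finset.range s).biUnion (fun l => y (T l) ∩ reg R T y l) :=
    Finset.biUnion_congr rfl fun l hl => by rw [regs_eq_reg y (mem_range.1 hl)]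
  rw [show reg R T y s = regs R T y (s + 1) s from rfl, regs_succ, if_neg (lt_irrefl s), if_pos rfl, hb1, hb2]

/-- **The regions are recovered from the output**: for every step `s < r`, `reg (seqSplice x) s = R s (x 0)`.
[cite: GladkovZimin2024, proof of Lemma 4.2 (uniqueness of the tree path); k-copy sequential form] -/
theorem reg_seqSplice [NeZero k] (hd : RegionsDisjoint R r) (hdet : RegionsDetermined R r)
    (x : Fin k → Finset ι) : ∀ s, s < r → reg R T (seqSplice R T r x) s = R s (x 0) := by
  intro s
  induction s using Nat.strong_induction_on with
  | _ s ih =>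
    intro hs
    rw [reg_eq]
    apply hdet s hs
    rintro i ⟨j, hjs, hij⟩
    -- `i ∈ R j (x 0)` with `j ≤ s`; the output copy `T j` carries the bit of `x 0` at `i`
    have hyT : ∀ {l}, l < r → i ∈ R l (x 0) → (i ∈ seqSplice R T r x (T l) ↔ i ∈ x 0) := by
      intro l hl hil
      by_cases hT0 : T l = 0
      · rw [hT0, mem_seqSplice_zero_of_mem hd hl hil, hT0]
      · rw [seqSplice_ne_zero x hT0, mem_splice_of_mem (mem_recv.2 ⟨l, hl, rfl, hil⟩)]
    have hjr : j < r := Nat.lt_of_le_of_lt hjs hs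
    simp only [mem_union, mem_sdiff, mem_biUnion, mem_range, mem_inter]
    rcases Nat.lt_or_eq_of_le hjs with hlt | heq
    · -- j < s: i lies in the reconstructed region j = R j (x 0)
      have hregj : reg R T (seqSplice R T r x) j = R j (x 0) := ih j hlt hjr
      constructor
      · intro hx0
        exact Or.inr ⟨j, hlt, (hyT hjr hij).2 hx0, by rw [hregj]; exact hij⟩
      · rintro (⟨-, hnot⟩ | ⟨l, hls, hyl, hil⟩)
        · exact absurd ⟨j, hlt, by rw [hregj]; exact hij⟩ hnot
        · have hlr : l < r := Nat.lt_trans hls hs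
          rw [ih l hls hlr] at hil
          have := step_unique hd hjr hlr hij hil
          subst this
          exact (hyT hjr hij).1 hyl
    · -- j = s: i is not in any earlier region
      subst heq
      have hnot : ¬ ∃ l, l < j ∧ i ∈ reg R T (seqSplice R T r x) l := by
        rintro ⟨l, hlj, hil⟩
        have hlr : l < r := Nat.lt_trans hlj hs
        rw [ih l hlj hlr] at hil
        exact absurd (step_unique hd hjr hlr hij hil) (Nat.ne_of_gt hlj)
      constructor
      · intro hx0; exact Or.inl ⟨(hyT hjr hij).2 hx0, hnot⟩
      · rintro (⟨hy, -⟩ | ⟨l, hlj, -, hil⟩)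
        · exact (hyT hjr hij).1 hy
        · exact absurd ⟨l, hlj, hil⟩ hnot

/-- The explicit left inverse of the program: with the regions reconstructed by `reg`, copy `0` takes back its bits from
the copies `T s` and every other copy takes back its bits from copy `0`. [cite: GladkovZimin2024, proof of Lemma 4.2;
k-copy sequential form] -/
def unSeqSplice [NeZero k] (R : ℕ → Finset ι → Finset ι) (T : ℕ → Fin k) (r : ℕ) (y : Fin k → Finset ι) :
    Fin k → Finset ι := fun j =>
  if j = 0 then ((y 0) \ (Finset.range r).biUnion (reg R T y)) ∪
      (Finset.range r).biUnion (fun s => y (T s) ∩ reg R T y s)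
  else splice ((Finset.range r).biUnion fun s => if T s = j then reg R T y s else ∅) (y 0) (y j)

/-- `unSeqSplice` is a left inverse of `seqSplice`. [cite: GladkovZimin2024, proof of Lemma 4.2; k-copy sequential form] -/
theorem unSeqSplice_seqSplice [NeZero k] (hd : RegionsDisjoint R r) (hdet : RegionsDetermined R r)
    (hT : ∀ s, s < r → T s ≠ 0) (x : Fin k → Finset ι) : unSeqSplice R T r (seqSplice R T r x) = x := by
  have hreg := reg_seqSplice (T := T) hd hdet x
  have hU : (Finset.range r).biUnion (reg R T (seqSplice R T r x)) = used R r (x 0) :=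
    Finset.biUnion_congr rfl fun s hs => hreg s (mem_range.1 hs)
  have hV : ∀ j, ((Finset.range r).biUnion fun s => if T s = j then reg R T (seqSplice R T r x) s else ∅) =
      recv R T r (x 0) j := fun j =>
    Finset.biUnion_congr rfl fun s hs => by rw [hreg s (mem_range.1 hs)]
  funext j
  by_cases hj0 : j = 0
  · subst hj0
    unfold unSeqSplice
    rw [if_pos rfl, hU]
    ext i
    simp only [mem_union, mem_sdiff, mem_biUnion, mem_range, mem_inter]
    by_cases hu : i ∈ used R r (x 0)
    · obtain ⟨s, hs, hi⟩ := mem_used.1 hu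
      have hTs : i ∈ seqSplice R T r x (T s) ↔ i ∈ x 0 := by
        rw [seqSplice_ne_zero x (hT s hs), mem_splice_of_mem (mem_recv.2 ⟨s, hs, rfl, hi⟩)]
      constructor
      · rintro (⟨-, hnu⟩ | ⟨s', hs', hy, hi'⟩)
        · exact absurd hu hnu
        · rw [hreg s' hs'] at hi'
          have := step_unique hd hs hs' hi hi'; subst this
          exact hTs.1 hy
      · intro hx; exact Or.inr ⟨s, hs, hTs.2 hx, by rw [hreg s hs]; exact hi⟩
    · rw [mem_seqSplice_zero_of_not_mem hu]
      constructor
      · rintro (⟨h, -⟩ | ⟨s', hs', -, hi'⟩)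
        · exact h
        · rw [hreg s' hs'] at hi'; exact absurd (mem_used.2 ⟨s', hs', hi'⟩) hu
      · intro h; exact Or.inl ⟨h, hu⟩
  · unfold unSeqSplice
    rw [if_neg hj0, hV j, seqSplice_ne_zero x hj0]
    ext i
    by_cases hi : i ∈ recv R T r (x 0) j
    · obtain ⟨s, hs, hTs, his⟩ := mem_recv.1 hi
      rw [mem_splice_of_mem hi, mem_seqSplice_zero_of_mem hd hs his, hTs]
    · rw [mem_splice_of_not_mem hi, mem_splice_of_not_mem hi]

/-- The sequential program is injective. [cite: GladkovZimin2024, proof of Lemma 4.2; k-copy sequential form] -/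
theorem seqSplice_injective [NeZero k] (hd : RegionsDisjoint R r) (hdet : RegionsDetermined R r)
    (hT : ∀ s, s < r → T s ≠ 0) : Function.Injective (seqSplice R T r) :=
  Function.LeftInverse.injective (unSeqSplice_seqSplice hd hdet hT)

/-- **Every sequential exploration program preserves `μ^{⊗k}`** (all `k`, all numbers of steps `r`): for regions that
are pairwise disjoint and determined forward, targets `≠ 0`, and every `f`,
`Σ_x wtKW x · f (seqSplice x) = Σ_x wtKW x · f x`.  The case `k = 3, r = 2` is the tree's
`DecisionTree.sum_wt3W_comp_splice3`. [cite: GladkovZimin2024, Lemma 4.2 and proof of Thm. 4.6; Gladkov2024, Lemma 3.1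
— k-copy sequential form, same counting proof] -/
theorem sum_wtKW_comp_seqSplice [NeZero k] (p : ι → ℝ) (hd : RegionsDisjoint R r) (hdet : RegionsDetermined R r)
    (hT : ∀ s, s < r → T s ≠ 0) (D : Finset ι) (f : (Fin k → Finset ι) → ℝ) :
    ∑ x ∈ tuplesK D k, wtKW D p x * f (seqSplice R T r x) = ∑ x ∈ tuplesK D k, wtKW D p x * f x :=
  sum_wtKW_comp_eq_of_injOn p (permutesCopiesK_seqSplice hd) D (fun _ hx => seqSplice_mem_tuplesK hx)
    (fun _ _ _ _ h => seqSplice_injective hd hdet hT h) f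

end Seq

end SwitchingK

end Summit.CriticalPhenomena.PercolationContinuityZ3.Theorems

end
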